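/-
Copyright: the b2b-balaban cell (near-miss cell 7), T⁴-continuum fan-out, NE7b ROUND-2 swarm `t4-ne7b-formalise-*`
(seat leaf-07, gen 2), row S6f «window-drop steps in the zone calculus» of lineage t4-ne7b-p1's claim table
`LEAVES-NE7b.md` (R-OWNER-22-2 (U2)).  Part II (the row's named deliverable).
Released under the licence of the surrounding project.
-/
import Summits.QuantumFields.BalabanUV.T4Continuum.Support.HistoryLevelsTorus
import Summits.QuantumFields.BalabanUV.T4Continuum.Support.HistoryZonesTolerant

/-!
# History zones with WINDOW-DROP STEPS: the levelled tolerant reading ⇒ dynamics, admissibility, multiplicity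

Summits-side support leaf of the T⁴-continuum cell (rung (B)+1 on a FINITE torus only; NOT infinite volume, NOT the
mass gap, NOT the Clay statement; NOT a proof of the spine estimate NE7b).  NE7b ROUND-2 swarm, row **S6f** of the
owner's claim table `LEAVES-NE7b.md` (R-OWNER-22-2 (U2), journal l.5911; located item G-ne7bp1g18-1): the (GM)
multiplicity of a tagged live genealogy when the large-field cube lattice of step `t` is the level-`lv t` blocking of
the cutoff-`K` torus (`lv` = the model scale `HistoryLevels.levelOf s K`, `R_j = L^{s_j}` by (2.5)), coarsening by
`L^{lv (t+1) − lv t} ∈ {1, L}` per step (`B16SProfile.ratio`) — by `1` exactly at the (2.5)-window drops, which are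
isolated (`B16SProfile.DropCtl`).  Until this row the certified sub-class displayed `NoDropInLife` (`lv = id`).

WHAT ([folklore] bookkeeping∕finite geometry on the lineage's OWN carriers; nothing is quoted from print, nothing
printed is asserted, no `[cite:]` tag, no `Prop` fact minted — `ZoneReadingD` is a HYPOTHESIS SHAPE).
* §1 **`ZoneReadingD sh n L K lv Cb c G zone`** = leaf-01's tolerant reading `HistoryZonesTolerant.ZoneReadingC` AT
  LEVELS: zones of step `t` in range `n·L^{K − lv t}`; birth diameter `≤ Cb·wtPEv (sh b)` at level `lv (sh b).step`;
  union ∕ shared cell at the merger's step; TOLERANT LEVELLED STEP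
  `zone (t+1) X ⊆ thickT _ c (blocks (L^{lv (t+1) − lv t}) (zone t X))`; renewals add nothing.
* §2 the DEFLATED realized extent **`extD`** `= theta lv ϑ t · diam` and **`zoneDynC_of_readingD`**: for a level function
  `lv` and any rate `σ` with `1 ≤ L·σ⁴`, `0 ≤ σ ≤ 1`, the deflated extent at `ϑ = σ²` obeys leaf-01's
  `ZoneDynC (step∘sh) (wtPEv∘sh) σ Cb (2c+1)` VERBATIM — the missing contraction at a plateau step is booked by the
  deflator one step later and recovered at the next (rising) step from `L·σ⁴ ≥ 1` (Bałaban's square root, B16 p. 385,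
  in the form `DropCtl.lag_two`).
* §3 **`admZ_of_readingD`**: the realized placement (root cells of scale `lv rootStep`, partners' root blocks at level
  `lv` of the merger step in their zones) is `AdmZ (nearD n L K lv (theta lv ϑ)) extD …` — the inflated radius
  `r∕θ_t` undoes the deflation exactly.
* §4 **`card_admZSet_le_of_readingD`**: the zone-admissible torus placements with the root piece at a given cell
  number at most `(2^d σ^{−2d}(C₀+2c₀+1)^d)^{#merges G}·∏_{e ∈ merges G} Q(wcntS sh G,σ,(sh e).step)^d·(L^d)^{partnerAges
  (step∘sh) G}`, `c₀ = (2c+1)∕(1−σ²)`, `C₀ = max Cb (c₀+1)`, for EVERY `σ` with `L^{−1∕2} ≤ σ² < 1` — row S6's consumer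
  shape (`HistorySocketZTH.shapeZTH`, `HistoryCrowdingTagged.zone_surchargeS_le`, whose zone constants `1 ≤ Kz`,
  `0 < σ < 1` are free) with `Kz ↦ σ^{−2d}·Kz(σ)`: NO credit spent, NO threshold, NO new display; on a drop-free life
  (`lv = id`, `theta ≡ 1`, `nearD = nearT` by `HistoryLevelsTorus.nearD_id`) it is leaf-01's `card_admZSet_le_of_readingC`
  up to the constant.
* §5 `zoneReadingD_of_readingC` (a tolerant reading is a levelled one for `lv = id`); §6 sanity.
What S12∕S6 pt 3 supply to use it: the physical zone map at levels (`ZoneReadingD` for `lv := levelOf s K`, from the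
realised regions exactly as for `ZoneReadingC`), `LevelFn K lv` (`HistoryLevels.levelFn_levelOf` from `DropCtl s K` and
the non-increase of `s`), and the choice of `σ` (e.g. `σ² = L^{−1∕2}`).  Walls unchanged: (ID) G-ne7bp1g9-1 (H3
displayed), (E2)∕(R1) G-ne7bp1-1.  NE7b discharge: no date.

HONEST DEPENDENCY (cell): continuum YM on T⁴ ⇐ BetaPertH ∧ nine spine estimates (0/9 proved); BetaPertH ⇐ (D1) ∧ (D4)
∧ CAP+tail; G-an2-4 gates asym, D1 and NE2/3/4.  This file changes none of it.
-/

open Finset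
open Literature.MathematicalPhysics.QuantumFieldTheory.Balaban1983to89
open T4PersistenceDictionary T4PartnerMultiplicity
open Summit.QuantumFields.BalabanUV.T4Continuum.PlacementSkeleton
open Summit.QuantumFields.BalabanUV.T4Continuum.Crowding
open Summit.QuantumFields.BalabanUV.T4Continuum.ZoneSkeleton
open Summit.QuantumFields.BalabanUV.T4Continuum.ZoneCrowd
open Summit.QuantumFields.BalabanUV.T4Continuum.ZoneTorus

namespace Summit.QuantumFields.BalabanUV.T4Continuum.HistoryZones

noncomputable section

variable {d : ℕ} {ε : Type*} [DecidableEq ε] (sh : ε → PEv)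

/-! ## §1 The levelled tolerant zone reading along a shape map -/

/-- **THE LEVELLED TOLERANT ZONE READING ALONG A SHAPE MAP**: `HistoryZonesTolerant.ZoneReadingC` with the zone of step
`t` a set of level-`lv t` block vectors (`n·L^{K − lv t}` a side) and the step law blocking by `L^{lv (t+1) − lv t}` — by
`L` at a rising step, by `1` at a plateau (window-drop) step. [folklore] -/
structure ZoneReadingD (n L K : ℕ) (lv : ℕ → ℕ) (Cb : ℝ) (c : ℕ) (G : Gen ε)
    (zone : ℕ → Gen ε → Finset (Fin d → ℕ)) : Prop where
  /-- zones of step `t` live on `(ℤ∕nL^{K − lv t})^d` -/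
  inRange : ∀ (t : ℕ) (X : Gen ε), Sub X G → InRange (n * L ^ (K - lv t)) (zone t X)
  /-- a birth's zone at its shape-step spans at most `Cb·wtPEv (sh b)` level-`lv` blocks -/
  birth : ∀ (b : ε) (j : ℕ), Sub (Gen.born b j) G →
    (diam (n * L ^ (K - lv (sh b).step)) (zone (sh b).step (Gen.born b j)) : ℝ) ≤ Cb * wtPEv (sh b)
  /-- at the merger's shape-step the merged zone lies inside the union of the partners' zones -/
  union : ∀ (X Y : Gen ε) (e : ε), Sub (Gen.merge X Y e) G →
    zone (sh e).step (Gen.merge X Y e) ⊆ zone (sh e).step X ∪ zone (sh e).step Y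
  /-- … and the partners' zones share a cell there -/
  overlap : ∀ (X Y : Gen ε) (e : ε), Sub (Gen.merge X Y e) G → ∃ z, z ∈ zone (sh e).step X ∧ z ∈ zone (sh e).step Y
  /-- TOLERANT LEVELLED STEP: one step later the zone lies inside the `c`-thickening of the zone blocked by
  `L^{lv (t+1) − lv t}` -/
  step : ∀ (X : Gen ε) (t : ℕ), Sub X G → ftime (PEv.step ∘ sh) X ≤ t → t + 1 ≤ K →
    zone (t + 1) X ⊆ thickT (n * L ^ (K - lv (t + 1))) c (blocks (L ^ (lv (t + 1) - lv t)) (zone t X))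
  /-- a renewal adds nothing to the zone -/
  renew : ∀ (X : Gen ε) (e : ε) (h t : ℕ), Sub (Gen.renew X e h) G → zone t (Gen.renew X e h) ⊆ zone t X

omit [DecidableEq ε] sh in
/-- blocking by `1` is the identity [folklore] -/
theorem blocks_one (S : Finset (Fin d → ℕ)) : blocks 1 S = S := by
  have h : blockVec (d := d) 1 = id := by
    funext u i
    simp [blockVec]
  rw [blocks, h, Finset.image_id]

/-! ## §2 The deflated realized extent and its dynamics -/

section Ext

open scoped Classical

/-- the guarded realized extent AT LEVELS: the diameter of `zone t X` on the level-`lv t` torus for sub-structures `X`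
of `G` formed by `t ≤ K`; `0` elsewhere. [folklore] -/
def extRD (n L K : ℕ) (lv : ℕ → ℕ) (G : Gen ε) (zone : ℕ → Gen ε → Finset (Fin d → ℕ)) (t : ℕ) (X : Gen ε) : ℝ :=
  if Sub X G ∧ ftime (PEv.step ∘ sh) X ≤ t ∧ t ≤ K then (diam (n * L ^ (K - lv t)) (zone t X) : ℝ) else 0

/-- **THE DEFLATED EXTENT**: the realized extent at levels times the deflator `theta lv ϑ t`. [folklore] -/
def extD (n L K : ℕ) (lv : ℕ → ℕ) (ϑ : ℝ) (G : Gen ε) (zone : ℕ → Gen ε → Finset (Fin d → ℕ)) (t : ℕ)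
    (X : Gen ε) : ℝ :=
  theta lv ϑ t * extRD sh n L K lv G zone t X

omit [DecidableEq ε] in
/-- `extRD ≥ 0` [folklore] -/
theorem extRD_nonneg (n L K : ℕ) (lv : ℕ → ℕ) (G : Gen ε) (zone : ℕ → Gen ε → Finset (Fin d → ℕ)) (t : ℕ)
    (X : Gen ε) : 0 ≤ extRD sh n L K lv G zone t X := by
  unfold extRD; split_ifs <;> positivity

omit [DecidableEq ε] in
/-- the realized extent on the guard [folklore] -/
theorem extRD_of_guard {n L K : ℕ} {lv : ℕ → ℕ} {G : Gen ε} {zone : ℕ → Gen ε → Finset (Fin d → ℕ)} {t : ℕ}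
    {X : Gen ε} (h1 : Sub X G) (h2 : ftime (PEv.step ∘ sh) X ≤ t) (h3 : t ≤ K) :
    extRD sh n L K lv G zone t X = (diam (n * L ^ (K - lv t)) (zone t X) : ℝ) := by
  simp [extRD, h1, h2, h3]

omit [DecidableEq ε] in
/-- `extD ≥ 0` for `0 ≤ ϑ ≤ 1` [folklore] -/
theorem extD_nonneg (n L K : ℕ) (lv : ℕ → ℕ) {ϑ : ℝ} (hϑ0 : 0 ≤ ϑ) (hϑ1 : ϑ ≤ 1) (G : Gen ε)
    (zone : ℕ → Gen ε → Finset (Fin d → ℕ)) (t : ℕ) (X : Gen ε) : 0 ≤ extD sh n L K lv ϑ G zone t X :=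
  mul_nonneg (hϑ0.trans (le_theta hϑ1 t)) (extRD_nonneg sh n L K lv G zone t X)

/-- **THE LEVELLED READING GIVES THE DYNAMICS OF THE DEFLATED EXTENT** (step constant `2c + 1`): for a level function
`lv`, `Cb ≥ 0`, and ANY rate `σ` with `0 ≤ σ ≤ 1`, `1 ≤ L·σ⁴`, the deflated extent at `ϑ = σ²` satisfies
`ZoneDynC (step∘sh) (wtPEv∘sh) σ Cb (2c+1)`.  At a plateau step the zone does not contract but the deflator drops
from `1` to `σ²`; at the following (rising) step the zone contracts by `1∕L ≤ σ²·σ²` while the deflator returns to `1`.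
[folklore] -/
theorem zoneDynC_of_readingD {n L K : ℕ} (hL : 1 ≤ L) {lv : ℕ → ℕ} (hlv : LevelFn K lv) {Cb σ : ℝ} (hCb : 0 ≤ Cb)
    (h0 : 0 ≤ σ) (h1 : σ ≤ 1) (hσL : 1 ≤ (L : ℝ) * σ ^ 4) {c : ℕ} {G : Gen ε}
    (hchr : Chrono (PEv.step ∘ sh) G) {zone : ℕ → Gen ε → Finset (Fin d → ℕ)}
    (hR : ZoneReadingD sh n L K lv Cb c G zone) :
    ZoneDynC (PEv.step ∘ sh) (wtPEv ∘ sh) σ Cb (2 * c + 1) (extD sh n L K lv (σ ^ 2) G zone) := by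
  have hϑ0 : 0 ≤ σ ^ 2 := sq_nonneg σ
  have hϑ1 : σ ^ 2 ≤ 1 := pow_le_one₀ h0 h1
  have hθ0 : ∀ t, 0 ≤ theta lv (σ ^ 2) t := fun t => hϑ0.trans (le_theta hϑ1 t)
  have hθ1 : ∀ t, theta lv (σ ^ 2) t ≤ 1 := theta_le_one hϑ1
  have hE0 : ∀ t X, 0 ≤ extRD sh n L K lv G zone t X := extRD_nonneg sh n L K lv G zone
  have hD0 : ∀ t X, 0 ≤ extD sh n L K lv (σ ^ 2) G zone t X := extD_nonneg sh n L K lv hϑ0 hϑ1 G zone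
  have hcS : (0 : ℝ) ≤ 2 * c + 1 := by positivity
  have hL0 : (0 : ℝ) < L := by exact_mod_cast hL
  refine ⟨fun b j => ?_, fun X Y e => ?_, fun X t hft => ?_, fun X e h t => ?_⟩
  · -- birth: deflation only helps
    show theta lv (σ ^ 2) (sh b).step * extRD sh n L K lv G zone (sh b).step (Gen.born b j) ≤ Cb * wtPEv (sh b)
    have hle : extRD sh n L K lv G zone (sh b).step (Gen.born b j) ≤ Cb * wtPEv (sh b) := by
      unfold extRD
      split_ifs with hg
      · exact hR.birth b j hg.1
      · exact mul_nonneg hCb (wtPEv_nonneg _)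
    calc theta lv (σ ^ 2) (sh b).step * extRD sh n L K lv G zone (sh b).step (Gen.born b j)
        ≤ 1 * extRD sh n L K lv G zone (sh b).step (Gen.born b j) := mul_le_mul_of_nonneg_right (hθ1 _) (hE0 _ _)
      _ ≤ Cb * wtPEv (sh b) := by rw [one_mul]; exact hle
  · -- merge: one deflator for the three extents at the merger's step
    show theta lv (σ ^ 2) (sh e).step * extRD sh n L K lv G zone (sh e).step (Gen.merge X Y e) ≤
      theta lv (σ ^ 2) (sh e).step * extRD sh n L K lv G zone (sh e).step X +
        theta lv (σ ^ 2) (sh e).step * extRD sh n L K lv G zone (sh e).step Y + 1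
    have key : extRD sh n L K lv G zone (sh e).step (Gen.merge X Y e) ≤
        extRD sh n L K lv G zone (sh e).step X + extRD sh n L K lv G zone (sh e).step Y := by
      by_cases hg : Sub (Gen.merge X Y e) G ∧ ftime (PEv.step ∘ sh) (Gen.merge X Y e) ≤ (sh e).step ∧ (sh e).step ≤ K
      · obtain ⟨hsub, -, hK⟩ := hg
        have hsX : Sub X G := Sub.trans (Sub.left Y e (Sub.refl X)) hsub
        have hsY : Sub Y G := Sub.trans (Sub.right X e (Sub.refl Y)) hsub
        obtain ⟨hfX, hfY⟩ := ftime_le_of_chrono (PEv.step ∘ sh) (chrono_of_sub (PEv.step ∘ sh) hsub hchr)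
        simp only [Function.comp_apply] at hfX hfY
        rw [extRD_of_guard sh (t := (sh e).step) hsub le_rfl hK, extRD_of_guard sh hsX hfX hK,
          extRD_of_guard sh hsY hfY hK]
        obtain ⟨z, hzX, hzY⟩ := hR.overlap X Y e hsub
        have h1' := diam_mono (m := n * L ^ (K - lv (sh e).step)) (hR.union X Y e hsub)
        have h2' := diam_union_le_of_overlap (hR.inRange _ X hsX) (hR.inRange _ Y hsY) hzX hzY
        exact_mod_cast h1'.trans h2'
      · have : extRD sh n L K lv G zone (sh e).step (Gen.merge X Y e) = 0 := by rw [extRD, if_neg hg]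
        rw [this]; linarith [hE0 (sh e).step X, hE0 (sh e).step Y]
    have := mul_le_mul_of_nonneg_left key (hθ0 (sh e).step)
    rw [mul_add] at this
    linarith
  · -- step: plateau (no blocking, deflator drops) or rise (blocking by `L`, deflator recovers)
    simp only [extD]
    by_cases hg : Sub X G ∧ ftime (PEv.step ∘ sh) X ≤ t + 1 ∧ t + 1 ≤ K
    · obtain ⟨hsub, -, hK⟩ := hg
      have hK' : t ≤ K := Nat.le_of_succ_le hK
      have hlvK : lv (t + 1) ≤ K := hlv.le_K (t + 1) hK
      rw [extRD_of_guard sh hsub (Nat.le_succ_of_le hft) hK, extRD_of_guard sh hsub hft hK']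
      have hstep := hR.step X t hsub hft hK
      have hDt : (0 : ℝ) ≤ diam (n * L ^ (K - lv t)) (zone t X) := Nat.cast_nonneg _
      rcases hlv.succ_eq_or t with hplat | hrise
      · -- plateau step
        rw [theta_eq_one_of_plateau hlv hplat, theta_succ_of_plateau hplat, hplat]
        rw [hplat, Nat.sub_self, pow_zero, blocks_one] at hstep
        have hIR : InRange (n * L ^ (K - lv t)) (zone t X) := hR.inRange t X hsub
        have h1' := diam_mono (m := n * L ^ (K - lv t)) hstep
        have h2' := diam_thickT_le c hIR
        have hD : (diam (n * L ^ (K - lv t)) (zone (t + 1) X) : ℝ) ≤ diam (n * L ^ (K - lv t)) (zone t X) + 2 * c := by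
          exact_mod_cast h1'.trans h2'
        have hc0 : (0 : ℝ) ≤ c := Nat.cast_nonneg c
        nlinarith
      · -- rising step
        have hne : lv (t + 1) ≠ lv t := by omega
        rw [theta_succ_of_ne hne, one_mul]
        have hδ : lv (t + 1) - lv t = 1 := by omega
        rw [hδ, pow_one] at hstep
        have hm : n * L ^ (K - lv t) = n * L ^ (K - lv (t + 1)) * L := by
          rw [mul_assoc, ← pow_succ]; congr 2; omega
        have hIR : InRange (n * L ^ (K - lv (t + 1))) (blocks L (zone t X)) :=
          inRange_blocks hL (by rw [← hm]; exact hR.inRange t X hsub)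
        have h1' := diam_mono (m := n * L ^ (K - lv (t + 1))) hstep
        have h2' := diam_thickT_le c hIR
        have h3' := diam_blocks_le_real hL (n * L ^ (K - lv (t + 1))) (zone t X)
        rw [← hm] at h3'
        have hD : (diam (n * L ^ (K - lv (t + 1))) (zone (t + 1) X) : ℝ) ≤
            1 / (L : ℝ) * diam (n * L ^ (K - lv t)) (zone t X) + 1 + 2 * c := by
          calc (diam (n * L ^ (K - lv (t + 1))) (zone (t + 1) X) : ℝ)
              ≤ diam (n * L ^ (K - lv (t + 1))) (thickT (n * L ^ (K - lv (t + 1))) c (blocks L (zone t X))) := by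
                exact_mod_cast h1'
            _ ≤ diam (n * L ^ (K - lv (t + 1))) (blocks L (zone t X)) + 2 * c := by exact_mod_cast h2'
            _ ≤ 1 / (L : ℝ) * diam (n * L ^ (K - lv t)) (zone t X) + 1 + 2 * c := by linarith
        have hrate : 1 / (L : ℝ) ≤ σ ^ 2 * theta lv (σ ^ 2) t := by
          have hθt : σ ^ 2 ≤ theta lv (σ ^ 2) t := le_theta hϑ1 t
          calc 1 / (L : ℝ) ≤ σ ^ 4 := by rw [div_le_iff₀ hL0]; linarith
            _ = σ ^ 2 * σ ^ 2 := by ring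
            _ ≤ σ ^ 2 * theta lv (σ ^ 2) t := mul_le_mul_of_nonneg_left hθt hϑ0
        have h4 := mul_le_mul_of_nonneg_right hrate hDt
        linarith
    · have : extRD sh n L K lv G zone (t + 1) X = 0 := by rw [extRD, if_neg hg]
      rw [this, mul_zero]
      have h5 : 0 ≤ σ ^ 2 * (theta lv (σ ^ 2) t * extRD sh n L K lv G zone t X) :=
        mul_nonneg hϑ0 (mul_nonneg (hθ0 t) (hE0 t X))
      linarith
  · -- renew: nothing added
    show theta lv (σ ^ 2) t * extRD sh n L K lv G zone t (Gen.renew X e h) ≤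
      theta lv (σ ^ 2) t * extRD sh n L K lv G zone t X
    refine mul_le_mul_of_nonneg_left ?_ (hθ0 t)
    by_cases hg : Sub (Gen.renew X e h) G ∧ ftime (PEv.step ∘ sh) (Gen.renew X e h) ≤ t ∧ t ≤ K
    · obtain ⟨hsub, hft, hK⟩ := hg
      have hsX : Sub X G := Sub.trans (Sub.renew e h (Sub.refl X)) hsub
      rw [extRD_of_guard sh hsub hft hK, extRD_of_guard sh hsX hft hK]
      exact_mod_cast diam_mono (hR.renew X e h t hsub)
    · have : extRD sh n L K lv G zone t (Gen.renew X e h) = 0 := by rw [extRD, if_neg hg]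
      rw [this]; exact hE0 t X

end Ext

/-! ## §3 The realized placement is zone-admissible at levels -/

section Adm

open scoped Classical

/-- **THE REALIZED PLACEMENT IS ZONE-ADMISSIBLE AT LEVELS.**  `G : Gen ε` chronological for `step ∘ sh` with shapes
dated `≤ K`, read by `ZoneReadingD` for a level function `lv`, `G'` its finite-alphabet copy (`gmap val G' = G`); if
`P₀` puts every sub-structure's root on a cell of scale `lv rootStep` (p1) and at every merger the partners' root
blocks AT LEVEL `lv` of the merger's step lie in their zones (p2), then the placement is admissible for the levelled
nearness `nearD n L K lv (theta lv ϑ)` with the deflated extents `extD` (`0 < ϑ ≤ 1`): the inflated radius undoes the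
deflation. [folklore] -/
theorem admZ_of_readingD {n L K : ℕ} {lv : ℕ → ℕ} (hlv : LevelFn K lv) {ϑ : ℝ} (hϑ : 0 < ϑ) (hϑ1 : ϑ ≤ 1)
    {Cb : ℝ} {c : ℕ} {G : Gen ε} (hchr : Chrono (PEv.step ∘ sh) G) (hK : ∀ e ∈ G.events, (sh e).step ≤ K)
    {zone : ℕ → Gen ε → Finset (Fin d → ℕ)} (hR : ZoneReadingD sh n L K lv Cb c G zone) {E : Finset ε}
    {G' : Gen ↥E} (hG : gmap Subtype.val G' = G) (P₀ : ↥E → TCell d (n * L ^ K))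
    (hscale : ∀ X' : Gen ↥E, Sub X' G' → IsScale L (lv X'.rootStep) (P₀ X'.root))
    (hroot : ∀ (X' Y' : Gen ↥E) (e' : ↥E), Sub (Gen.merge X' Y' e') G' →
      (fun i => (P₀ X'.root i).val / L ^ lv (sh e'.1).step) ∈ zone (sh e'.1).step (gmap Subtype.val X') ∧
      (fun i => (P₀ Y'.root i).val / L ^ lv (sh e'.1).step) ∈ zone (sh e'.1).step (gmap Subtype.val Y')) :
    AdmZ (nearD n L K lv (theta lv ϑ)) (fun t Z => extD sh n L K lv ϑ G zone t (gmap Subtype.val Z))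
      ((PEv.step ∘ sh) ∘ Subtype.val) G' P₀ := by
  suffices h : ∀ X' : Gen ↥E, Sub X' G' →
      AdmZ (nearD n L K lv (theta lv ϑ)) (fun t Z => extD sh n L K lv ϑ G zone t (gmap Subtype.val Z))
        ((PEv.step ∘ sh) ∘ Subtype.val) X' P₀ from h G' (Sub.refl _)
  intro X' hX'
  induction X' with
  | born b j => trivial
  | renew X e h ih => exact ih (Sub.trans (Sub.renew e h (Sub.refl X)) hX')
  | merge A B e ihA ihB =>
      have hsA : Sub A G' := Sub.trans (Sub.left B e (Sub.refl A)) hX'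
      have hsB : Sub B G' := Sub.trans (Sub.right A e (Sub.refl B)) hX'
      refine ⟨ihA hsA, ihB hsB, ?_⟩
      have hsub : Sub (gmap Subtype.val (Gen.merge A B e)) G := hG ▸ sub_gmap Subtype.val hX'
      have hsubA : Sub (gmap Subtype.val A) G := hG ▸ sub_gmap Subtype.val hsA
      have hsubB : Sub (gmap Subtype.val B) G := hG ▸ sub_gmap Subtype.val hsB
      have hchr' : Chrono (PEv.step ∘ sh) (Gen.merge (gmap Subtype.val A) (gmap Subtype.val B) e.1) :=
        chrono_of_sub (PEv.step ∘ sh) hsub hchr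
      obtain ⟨hfA, hfB⟩ := ftime_le_of_chrono (PEv.step ∘ sh) hchr'
      simp only [Function.comp_apply] at hfA hfB
      have heK : (sh e.1).step ≤ K := hK e.1 (events_subset_of_sub hsub (by simp [gmap]))
      show nearD n L K lv (theta lv ϑ) (P₀ A.root) A.rootStep (P₀ B.root) B.rootStep (sh e.1).step
        (extD sh n L K lv ϑ G zone (sh e.1).step (gmap Subtype.val A) +
          extD sh n L K lv ϑ G zone (sh e.1).step (gmap Subtype.val B))
      unfold nearD
      simp only [extD]
      rw [extRD_of_guard sh hsubA hfA heK, extRD_of_guard sh hsubB hfB heK]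
      have hθ : theta lv ϑ (sh e.1).step ≠ 0 := (theta_pos hϑ hϑ1 _).ne'
      rw [← mul_add, mul_div_cancel_left₀ _ hθ]
      obtain ⟨z, hzA, hzB⟩ := hR.overlap _ _ e.1 hsub
      obtain ⟨hrA, hrB⟩ := hroot A B e hX'
      exact nearT_of_mem_overlap n L K (hlv.le_K _ heK) (hscale A hsA) (hscale B hsB) (hR.inRange _ _ hsubA)
        (hR.inRange _ _ hsubB) hrA hrB hzA hzB

end Adm

/-! ## §4 The count under the levelled tolerant reading -/

section Count

open scoped Classical

/-- **THE (GM) MULTIPLICITY OF A TAGGED GENEALOGY WITH WINDOW-DROP STEPS.**  For `G : Gen ε` well-formed,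
chronological for `step ∘ sh`, with kind-`0` birth shapes and non-kind-`0` merger shapes, events in `E`, read AT LEVELS
by `ZoneReadingD sh n L K lv Cb c G zone` for a level function `lv` (`Cb ≥ 0`), and ANY rate `σ` with `0 < σ < 1`,
`1 ≤ L·σ⁴`: with `c₀ := (2c+1)∕(1−σ²)`, `C₀ := max Cb (c₀ + 1)`, the zone-admissible torus placements of
`grestrict E G hE` (levelled nearness `nearD n L K lv (theta lv σ²)`, deflated extents `extD`) with the root piece
at `z` number at most
`(2^d σ^{−2d}(C₀ + 2c₀ + 1)^d)^{#merges G}·(∏_{e ∈ merges G} Q(wcntS sh G,σ,(sh e).step)^(d:ℝ))·(L^d)^{partnerAges (step∘sh) G}`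
— row S6's consumer shape with `Kz ↦ σ^{−2d}·Kz`. [folklore] -/
theorem card_admZSet_le_of_readingD (W : ε → ℕ) (n : ℕ) {L : ℕ} (hL : 1 ≤ L) (K : ℕ) {lv : ℕ → ℕ}
    (hlv : LevelFn K lv) {Cb σ : ℝ} (hCb : 0 ≤ Cb) (h0 : 0 < σ) (h1 : σ < 1) (hσL : 1 ≤ (L : ℝ) * σ ^ 4) {c : ℕ}
    {G : Gen ε} (hW : G.WF W) (hchr : Chrono (PEv.step ∘ sh) G) (hk0 : ∀ b ∈ births G, (sh b).kind = 0)
    (hk2 : ∀ m ∈ merges G, (sh m).kind ≠ 0) {zone : ℕ → Gen ε → Finset (Fin d → ℕ)}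
    (hR : ZoneReadingD sh n L K lv Cb c G zone) (E : Finset ε) (hE : G.events ⊆ E) (z c₀' : TCell d (n * L ^ K)) :
    ((admZSet (nearD n L K lv (theta lv (σ ^ 2))) (fun t Z => extD sh n L K lv (σ ^ 2) G zone t (gmap Subtype.val Z))
        ((PEv.step ∘ sh) ∘ Subtype.val) (grestrict E G hE) (grestrict E G hE).root z c₀').card : ℝ) ≤
      ((2 : ℝ) ^ d * (σ ^ 2)⁻¹ ^ d *
          (max Cb ((2 * c + 1) / (1 - σ ^ 2) + 1) + 2 * ((2 * c + 1) / (1 - σ ^ 2)) + 1) ^ d) ^ (merges G).card *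
        (∏ e ∈ merges G, Q (wcntS sh G) σ (sh e).step ^ (d : ℝ)) *
          ((L : ℝ) ^ d) ^ partnerAges (PEv.step ∘ sh) G := by
  have hs1 : σ ^ 2 < 1 := by nlinarith
  have hϑ0 : 0 < σ ^ 2 := by positivity
  have hcS : (0 : ℝ) ≤ 2 * c + 1 := by positivity
  have hc0 : 0 ≤ (2 * c + 1) / (1 - σ ^ 2) := div_nonneg hcS (sub_pos.2 hs1).le
  set C₀ := max Cb ((2 * c + 1) / (1 - σ ^ 2) + 1) with hC₀
  have hC : 0 ≤ C₀ := le_max_of_le_right (by linarith)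
  have dyn := zoneDynC_of_readingD sh hL hlv hCb h0.le h1.le hσL hchr hR
  have hlaw := guardExt_le_affineC W (fun w => one_le_wtPEv (sh w)) h0.le h1 hcS dyn (le_max_left _ _)
    (le_max_right _ _)
  have hGG : gmap Subtype.val (grestrict E G hE) = G := gmap_grestrict E G hE
  have hset : admZSet (nearD n L K lv (theta lv (σ ^ 2)))
        (fun t Z => extD sh n L K lv (σ ^ 2) G zone t (gmap Subtype.val Z))
        ((PEv.step ∘ sh) ∘ Subtype.val) (grestrict E G hE) (grestrict E G hE).root z c₀' =
      admZSet (nearD n L K lv (theta lv (σ ^ 2)))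
        (fun t Z => guardExt W (PEv.step ∘ sh) (extD sh n L K lv (σ ^ 2) G zone) t (gmap Subtype.val Z))
        ((PEv.step ∘ sh) ∘ Subtype.val) (grestrict E G hE) (grestrict E G hE).root z c₀' := by
    unfold admZSet
    refine filter_congr fun P _ => ?_
    rw [admZ_guard_gmap_iff (nearD n L K lv (theta lv (σ ^ 2))) W (PEv.step ∘ sh) (extD sh n L K lv (σ ^ 2) G zone)
      Subtype.val (by rw [hGG]; exact hW) (by rw [hGG]; exact hchr) P]
  rw [hset]
  exact card_admZSet_grestrict_leD sh W n hL K hlv hϑ0 (theta_le_one hs1.le) (le_theta hs1.le)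
    (guardExt W (PEv.step ∘ sh) (extD sh n L K lv (σ ^ 2) G zone))
    (guardExt_nonneg W (PEv.step ∘ sh) (extD_nonneg sh n L K lv hϑ0.le hs1.le G zone)) hC hc0 h0.le hlaw hW hchr
    hk0 hk2 E hE z c₀'

end Count

/-! ## §5 The drop-free junction: a tolerant reading IS a levelled reading for `lv = id` -/

omit [DecidableEq ε] in
/-- **THE `NoDropInLife` JUNCTION ON THE READING SIDE**: leaf-01's tolerant reading is the levelled tolerant reading
for the identity level function (blocking by `L^{(t+1) − t} = L` at every step). [folklore] -/
theorem zoneReadingD_of_readingC {n L K : ℕ} {Cb : ℝ} {c : ℕ} {G : Gen ε}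
    {zone : ℕ → Gen ε → Finset (Fin d → ℕ)} (hR : ZoneReadingC sh n L K Cb c G zone) :
    ZoneReadingD sh n L K (fun t => t) Cb c G zone where
  inRange := hR.inRange
  birth := hR.birth
  union := hR.union
  overlap := hR.overlap
  step X t hs hft hK := by simpa only [Nat.add_sub_cancel_left, pow_one] using hR.step X t hs hft hK
  renew := hR.renew

/-! ## §6 Sanity (decided ∕ closed instances) -/

namespace SanityZD

/-- blocking by `L^0 = 1` at a plateau step leaves a zone unchanged (one coordinate, `ℤ∕9`) -/
example : blocks (5 ^ (3 - 3)) ({![4], ![7]} : Finset (Fin 1 → ℕ)) = {![4], ![7]} := by decide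

/-- the rate condition `1 ≤ L·σ⁴` at `L = 16`, `σ² = 1∕4 = L^{−1∕2}` (the smallest admissible rate), with equality -/
example : (1 : ℝ) ≤ 16 * (1 / 2 : ℝ) ^ 4 := by norm_num

end SanityZD

end

end Summit.QuantumFields.BalabanUV.T4Continuum.HistoryZones
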